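import Mathlib
import HarnessLib
import Summits.NavierStokesRegularity.NavierStokesRegularity.Theorems.UnthreadedRigidityDoorUnthreadedRigidityMixedPairOrderOne
import Summits.NavierStokesRegularity.NavierStokesRegularity.Theorems.UnthreadedRigidityDoorUnthreadedRigidityPersistenceSphereLaw

/-!
# Route `UnthreadedRigidityDoor`, item `UnthreadedRigidity` (W2, stmt-NavierStokesRegularity-27585) — LINE g11-2 «MIXED PAIR» meets
# LINE g12-2 «PERSISTENCE»: TOOLS for the pair sphere law (parity of curls, a binary quartic alternative, binary expansions, `Q = 0`)

Prover file (engine-1 g73; `--supports stmt-NavierStokesRegularity-27585 --as helper`; route-independent imports).  Elementary tools used by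
`…MixedPairSphereLaw` (the pair sphere law) and `…MixedPairWindowRigidityHolds` (★★ `MixedPairWindowRigidity` unconditional):

* §1 `fderiv_comp_neg'`, `curl_neg_of_even` / `curl_neg_of_odd` — THE CURL OF AN EVEN FIELD IS ODD and vice versa (`D(G∘(−))(z) = −DG(−z)`);
* §2 ★ `binary_quartic_alternative` — if `N·(Ac² + 2Bcs + Cs²)²` agrees with a binary quadratic form `l₁c² + 2l₂cs + l₃s²` on the unit circle,
  then `N = 0` or (`A = C` and `B = 0`): the five points `(1,0)`, `(0,1)`, `(1,±1)/√2`, `(2,1)/√5` give `N·(4B² − (A−C)²) = 0` and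
  `N·B(A−C) = 0` (the two conditions for `c² + s²` to divide the quartic);
* §3 `gradient_neg_of_even`, `gradient_at_neg_of_even` (the gradient of an even function is odd), `norm_sq_orthonormal_pair`,
  `norm_orthonormal_pair`, the binary expansions `inner_apply_pair` (`⟪Q(cv+sw), cv+sw⟫`), `inner_sq_pair` (`⟪a, cv+sw⟫²`), `norm_sq_apply_pair`
  (`‖Q(cv+sw)‖²`) for an orthonormal pair, `inner_e_e`, and ★ `eq_zero_of_coordinate_planes` — a traceless symmetric `Q` whose
  restrictions to the three coordinate planes are multiples of the identity form vanishes;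
* §4 `dipoleShell_even`, `quadShell_odd` — the centred potential shells `(h(|z|²)⟪a,z⟫)z` / `(h(|z|²) zᵀQz)z` are even / odd in `z`.

HONEST LABEL: elementary linear algebra / calculus tools for a rung line about SPECIAL two-shell data; nothing here bears on `UnthreadedRigidity`
(27585), the door Target, W2 or Navier–Stokes regularity; no summit statement is proved.  0 kit.
-/

noncomputable section

-- the summit and its single sub-problem share the name (CONVENTIONS §1), as in every Theorems file
set_option linter.dupNamespace false

namespace Summit.NavierStokesRegularity.NavierStokesRegularity.Theorems.UnthreadedRigidity.MixedPair

open Set Function Filter Topology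
open scoped RealInnerProductSpace ContDiff
open Literature.Analysis Literature.Analysis.FluidPDE
open Summit.NavierStokesRegularity.NavierStokesRegularity.Theorems.UnthreadedRigidity.ProfileHorn (E3)
open Summit.NavierStokesRegularity.NavierStokesRegularity.Theorems.UnthreadedRigidity.VirialHorn
  (e IsSolidHarmonic VirialAdmissible sepShellL vortAmpL strainAmpL sepShellL_eq_comp_sub curl_comp_sub_const_fun contDiff_shell
    contDiff_top_sepShellL curl_curl_shell_apply curl_shell_eq)
open Summit.NavierStokesRegularity.NavierStokesRegularity.Theorems.UnthreadedRigidity.Persistence (singleShellLambCurlIdentity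
  eq_of_cross_gradient_eq_zero_on_sphere differentiableAt_lambPot)

/-! ## §1 Parity tools -/

section Parity

/-- `D(G ∘ (−))(z) = −DG(−z)`. [folklore] -/
theorem fderiv_comp_neg' {G : E3 → E3} (hG : Differentiable ℝ G) (z : E3) :
    fderiv ℝ (fun x : E3 => G (-x)) z = -fderiv ℝ G (-z) := by
  have h1 : HasFDerivAt (fun x : E3 => -x) (-(ContinuousLinearMap.id ℝ E3)) z := (hasFDerivAt_id z).neg
  have h2 : HasFDerivAt (fun x : E3 => G (-x)) ((fderiv ℝ G (-z)).comp (-(ContinuousLinearMap.id ℝ E3))) z :=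
    (hG (-z)).hasFDerivAt.comp z h1
  rw [h2.fderiv]
  ext v
  simp

/-- THE CURL OF AN EVEN FIELD IS ODD: `G(−z) = G(z)` ⇒ `curl G (−z) = −curl G z`. [folklore] -/
theorem curl_neg_of_even {G : E3 → E3} (hG : Differentiable ℝ G) (heven : ∀ z : E3, G (-z) = G z) (z : E3) :
    curl G (-z) = -curl G z := by
  have hfun : (fun x : E3 => G (-x)) = G := funext heven
  have h := fderiv_comp_neg' hG z
  rw [hfun] at h
  -- `fderiv G z = −fderiv G (−z)`
  rw [curl_eq_curlCLM, curl_eq_curlCLM, h, map_neg, neg_neg]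

/-- THE CURL OF AN ODD FIELD IS EVEN: `G(−z) = −G(z)` ⇒ `curl G (−z) = curl G z`. [folklore] -/
theorem curl_neg_of_odd {G : E3 → E3} (hG : Differentiable ℝ G) (hodd : ∀ z : E3, G (-z) = -G z) (z : E3) :
    curl G (-z) = curl G z := by
  have hfun : (fun x : E3 => G (-x)) = fun x => -G x := funext hodd
  have h := fderiv_comp_neg' hG z
  rw [hfun, fderiv_fun_neg] at h
  -- `−fderiv G z = −fderiv G (−z)`
  rw [curl_eq_curlCLM, curl_eq_curlCLM, neg_inj.1 h]

end Parity

/-! ## §2 The binary quartic alternative -/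

section Binary

/-- ★ A BINARY QUARTIC THAT IS A QUADRATIC FORM ON THE CIRCLE: if `N·(Ac² + 2Bcs + Cs²)² = l₁c² + 2l₂cs + l₃s²` whenever `c² + s² = 1`, then
`N = 0` or (`A = C` and `B = 0`) — five points of the circle, `(1,0)`, `(0,1)`, `(1,±1)/√2`, `(2,1)/√5`, give `N·B(A − C) = 0` and
`N·(4B² − (A − C)²) = 0` (the quartic is divisible by `c² + s²` iff it vanishes at `(i,1)`). [folklore] -/
theorem binary_quartic_alternative {N A B C l₁ l₂ l₃ : ℝ}
    (h : ∀ c s : ℝ, c ^ 2 + s ^ 2 = 1 → N * (A * c ^ 2 + 2 * B * c * s + C * s ^ 2) ^ 2 = l₁ * c ^ 2 + 2 * l₂ * c * s + l₃ * s ^ 2) :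
    N = 0 ∨ (A = C ∧ B = 0) := by
  -- the five evaluations
  have E1 := h 1 0 (by norm_num)
  have E2 := h 0 1 (by norm_num)
  have hq : (Real.sqrt 2 / 2) ^ 2 = 1 / 2 := by
    rw [div_pow, Real.sq_sqrt (by norm_num : (0 : ℝ) ≤ 2)]; norm_num
  have hq' : (Real.sqrt 2 / 2) * (Real.sqrt 2 / 2) = 1 / 2 := by rw [← sq, hq]
  have E3 := h (Real.sqrt 2 / 2) (Real.sqrt 2 / 2) (by rw [hq]; norm_num)
  have E4 := h (Real.sqrt 2 / 2) (-(Real.sqrt 2 / 2)) (by rw [neg_sq, hq]; norm_num)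
  have hf : (2 / Real.sqrt 5) ^ 2 = 4 / 5 := by
    rw [div_pow, Real.sq_sqrt (by norm_num : (0 : ℝ) ≤ 5)]; norm_num
  have hf' : (1 / Real.sqrt 5) ^ 2 = 1 / 5 := by
    rw [div_pow, Real.sq_sqrt (by norm_num : (0 : ℝ) ≤ 5)]; norm_num
  have hf'' : (2 / Real.sqrt 5) * (1 / Real.sqrt 5) = 2 / 5 := by
    rw [div_mul_div_comm, ← sq, Real.sq_sqrt (by norm_num : (0 : ℝ) ≤ 5)]; norm_num
  have E5 := h (2 / Real.sqrt 5) (1 / Real.sqrt 5) (by rw [hf, hf']; norm_num)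
  -- reduce to rational identities
  have E3' : N * (A * (1 / 2) + 2 * B * (1 / 2) + C * (1 / 2)) ^ 2 = l₁ * (1 / 2) + 2 * l₂ * (1 / 2) + l₃ * (1 / 2) := by
    have := E3
    simp only [mul_assoc] at this ⊢
    rw [hq', hq] at this
    linear_combination this
  have E4' : N * (A * (1 / 2) - 2 * B * (1 / 2) + C * (1 / 2)) ^ 2 = l₁ * (1 / 2) - 2 * l₂ * (1 / 2) + l₃ * (1 / 2) := by
    have := E4
    rw [neg_sq, hq] at this
    have hn : (Real.sqrt 2 / 2) * -(Real.sqrt 2 / 2) = -(1 / 2) := by rw [mul_neg, hq']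
    simp only [mul_assoc] at this ⊢
    rw [hn] at this
    linear_combination this
  have E5' : N * (A * (4 / 5) + 2 * B * (2 / 5) + C * (1 / 5)) ^ 2 = l₁ * (4 / 5) + 2 * l₂ * (2 / 5) + l₃ * (1 / 5) := by
    have := E5
    simp only [mul_assoc] at this ⊢
    rw [hf'', hf, hf'] at this
    linear_combination this
  simp only [one_pow, mul_one, zero_pow two_ne_zero, mul_zero, add_zero, zero_add] at E1 E2
  -- the two divisibility conditions
  have I1 : N * (4 * B ^ 2 - (A - C) ^ 2) = 0 := by
    linear_combination 2 * E3' + 2 * E4' - 2 * E1 - 2 * E2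
  have I2 : N * (B * (A - C)) = 0 := by
    linear_combination (25 / 12) * E5' - E1 + (1 / 4) * E2 - (3 / 2) * E3' + (1 / 6) * E4'
  by_cases hN : N = 0
  · exact Or.inl hN
  right
  have J1 : 4 * B ^ 2 - (A - C) ^ 2 = 0 := (mul_eq_zero.1 I1).resolve_left hN
  have J2 : B * (A - C) = 0 := (mul_eq_zero.1 I2).resolve_left hN
  rcases mul_eq_zero.1 J2 with hB | hAC
  · rw [hB] at J1
    have : (A - C) ^ 2 = 0 := by linarith
    exact ⟨by nlinarith [sq_nonneg (A - C)], hB⟩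
  · have hAC' : A = C := by linarith
    rw [hAC'] at J1
    have : B ^ 2 = 0 := by linarith
    exact ⟨hAC', pow_eq_zero_iff two_ne_zero |>.1 this⟩

end Binary

/-! ## §3 Small tools: gradient parity, orthonormal pairs, binary expansions, the `Q = 0` criterion -/

section Tools

/-- THE GRADIENT OF AN EVEN FUNCTION IS ODD (at points of differentiability). [folklore] -/
theorem gradient_neg_of_even {f : E3 → ℝ} (heven : ∀ z : E3, f (-z) = f z) {y : E3} (hf : DifferentiableAt ℝ f (-y)) :
    gradient f y = -gradient f (-y) := by
  have hfun : (fun x : E3 => f (-x)) = f := funext heven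
  have h1 : HasFDerivAt (fun x : E3 => -x) (-(ContinuousLinearMap.id ℝ E3)) y := (hasFDerivAt_id y).neg
  have h2 : HasFDerivAt (fun x : E3 => f (-x)) ((fderiv ℝ f (-y)).comp (-(ContinuousLinearMap.id ℝ E3))) y :=
    hf.hasFDerivAt.comp y h1
  rw [hfun] at h2
  rw [gradient, gradient, h2.fderiv]
  have : (fderiv ℝ f (-y)).comp (-(ContinuousLinearMap.id ℝ E3)) = -fderiv ℝ f (-y) := by
    ext v; simp
  rw [this, map_neg]

/-- the gradient of an even function at `−y`. [folklore] -/
theorem gradient_at_neg_of_even {f : E3 → ℝ} (heven : ∀ z : E3, f (-z) = f z) {y : E3} (hf : DifferentiableAt ℝ f y) :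
    gradient f (-y) = -gradient f y := by
  have h := gradient_neg_of_even heven (y := -y) (by rw [neg_neg]; exact hf)
  rw [neg_neg] at h
  exact h

variable {v w : E3}

/-- `‖c v + s w‖² = c² + s²` for an orthonormal pair. [folklore] -/
theorem norm_sq_orthonormal_pair (hv : ‖v‖ = 1) (hw : ‖w‖ = 1) (hvw : ⟪v, w⟫ = 0) (c s : ℝ) :
    ‖c • v + s • w‖ ^ 2 = c ^ 2 + s ^ 2 := by
  rw [norm_add_sq_real, norm_smul, norm_smul, real_inner_smul_left, real_inner_smul_right, hvw, hv, hw, Real.norm_eq_abs,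
    Real.norm_eq_abs, mul_one, mul_one, sq_abs, sq_abs, mul_zero, mul_zero, mul_zero, add_zero]

/-- `c v + s w` is a unit vector when `c² + s² = 1`. [folklore] -/
theorem norm_orthonormal_pair (hv : ‖v‖ = 1) (hw : ‖w‖ = 1) (hvw : ⟪v, w⟫ = 0) {c s : ℝ} (hcs : c ^ 2 + s ^ 2 = 1) :
    ‖c • v + s • w‖ = 1 := by
  have h := norm_sq_orthonormal_pair hv hw hvw c s
  rw [hcs] at h
  have hn : 0 ≤ ‖c • v + s • w‖ := norm_nonneg _
  nlinarith [h, hn]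

/-- binary expansion of the quadratic form `z ↦ ⟪Qz, z⟫` (symmetric `Q`). [folklore] -/
theorem inner_apply_pair {Q : E3 →L[ℝ] E3} (hQ : ∀ p q : E3, ⟪Q p, q⟫ = ⟪p, Q q⟫) (c s : ℝ) :
    ⟪Q (c • v + s • w), c • v + s • w⟫ = c ^ 2 * ⟪Q v, v⟫ + 2 * c * s * ⟪Q v, w⟫ + s ^ 2 * ⟪Q w, w⟫ := by
  have hwv : ⟪Q w, v⟫ = ⟪Q v, w⟫ := by rw [hQ w v, real_inner_comm]
  simp only [map_add, map_smul, inner_add_left, inner_add_right, real_inner_smul_left, real_inner_smul_right, hwv]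
  ring

/-- binary expansion of `z ↦ ⟪a, z⟫²`. [folklore] -/
theorem inner_sq_pair (a : E3) (c s : ℝ) :
    ⟪a, c • v + s • w⟫ ^ 2 = c ^ 2 * ⟪a, v⟫ ^ 2 + 2 * c * s * (⟪a, v⟫ * ⟪a, w⟫) + s ^ 2 * ⟪a, w⟫ ^ 2 := by
  simp only [inner_add_right, real_inner_smul_right]
  ring

/-- binary expansion of `z ↦ ‖Qz‖²`. [folklore] -/
theorem norm_sq_apply_pair (Q : E3 →L[ℝ] E3) (c s : ℝ) :
    ‖Q (c • v + s • w)‖ ^ 2 = c ^ 2 * ‖Q v‖ ^ 2 + 2 * c * s * ⟪Q v, Q w⟫ + s ^ 2 * ‖Q w‖ ^ 2 := by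
  rw [← real_inner_self_eq_norm_sq, ← real_inner_self_eq_norm_sq, ← real_inner_self_eq_norm_sq]
  have hwv : ⟪Q w, Q v⟫ = ⟪Q v, Q w⟫ := real_inner_comm _ _
  simp only [map_add, map_smul, inner_add_left, inner_add_right, real_inner_smul_left, real_inner_smul_right, hwv]
  ring

/-- the standard basis vectors `e i` are orthonormal. [folklore] -/
theorem inner_e_e (i j : Fin 3) : ⟪e i, e j⟫ = if i = j then (1 : ℝ) else 0 := by
  fin_cases i <;> fin_cases j <;> simp [e, EuclideanSpace.inner_single_left]

/-- THE `Q = 0` CRITERION: a traceless symmetric `Q` whose binary restrictions to the three coordinate planes are all multiples of the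
identity form (`⟪Qeᵢ,eᵢ⟫ = ⟪Qeⱼ,eⱼ⟫`, `⟪Qeᵢ,eⱼ⟫ = 0` for `i ≠ j`) vanishes. [folklore] -/
theorem eq_zero_of_coordinate_planes {Q : E3 →L[ℝ] E3} (hQ : IsTracelessSymmetric Q)
    (h01 : ⟪Q (e 0), e 0⟫ = ⟪Q (e 1), e 1⟫ ∧ ⟪Q (e 0), e 1⟫ = 0)
    (h02 : ⟪Q (e 0), e 0⟫ = ⟪Q (e 2), e 2⟫ ∧ ⟪Q (e 0), e 2⟫ = 0)
    (h12 : ⟪Q (e 1), e 1⟫ = ⟪Q (e 2), e 2⟫ ∧ ⟪Q (e 1), e 2⟫ = 0) : Q = 0 := by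
  obtain ⟨hsym, htr⟩ := hQ
  have htr' : ⟪Q (e 0), e 0⟫ + ⟪Q (e 1), e 1⟫ + ⟪Q (e 2), e 2⟫ = 0 := by
    simpa [Fin.sum_univ_three] using htr
  have hd0 : ⟪Q (e 0), e 0⟫ = 0 := by linarith [h01.1, h02.1]
  have hd1 : ⟪Q (e 1), e 1⟫ = 0 := by linarith [h01.1, h02.1]
  have hd2 : ⟪Q (e 2), e 2⟫ = 0 := by linarith [h01.1, h02.1]
  -- all matrix entries vanish
  have hent : ∀ i j : Fin 3, ⟪Q (e i), e j⟫ = 0 := by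
    have h10 : ⟪Q (e 1), e 0⟫ = 0 := by rw [hsym, real_inner_comm]; exact h01.2
    have h20 : ⟪Q (e 2), e 0⟫ = 0 := by rw [hsym, real_inner_comm]; exact h02.2
    have h21 : ⟪Q (e 2), e 1⟫ = 0 := by rw [hsym, real_inner_comm]; exact h12.2
    intro i j
    fin_cases i <;> fin_cases j
    all_goals first | exact hd0 | exact hd1 | exact hd2 | exact h01.2 | exact h02.2 | exact h12.2 | exact h10 | exact h20 | exact h21
  -- hence `Q eᵢ = 0` for each `i`, hence `Q = 0`
  have hcol : ∀ i : Fin 3, Q (e i) = 0 := by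
    intro i
    ext j
    have := hent i j
    rw [show ⟪Q (e i), e j⟫ = Q (e i) j from by
      rw [show e j = EuclideanSpace.single j (1 : ℝ) from rfl, EuclideanSpace.inner_single_right]; simp] at this
    simpa using this
  have hbasis : ∀ z : E3, z = ∑ i : Fin 3, z i • e i := fun z => by
    ext k
    simp [e, Fin.sum_univ_three]
    fin_cases k <;> simp
  ext z k
  rw [hbasis z, map_sum]
  simp [map_smul, hcol]

end Tools

/-! ## §4 The parities of the two shells and their vorticities -/

section ShellParity

variable {a : E3} {Q : E3 →L[ℝ] E3}

/-- the centred dipole potential shell `(h(|z|²)⟪a,z⟫) z` is EVEN. [folklore] -/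
theorem dipoleShell_even (h : ℝ → ℝ) (a z : E3) :
    (fun z : E3 => (h (‖z‖ ^ 2) * dipoleHarmonic a z) • z) (-z) = (fun z : E3 => (h (‖z‖ ^ 2) * dipoleHarmonic a z) • z) z := by
  simp only [dipoleHarmonic, norm_neg, inner_neg_right, mul_neg, neg_smul, smul_neg, neg_neg]

/-- the centred quadrupole potential shell `(h(|z|²) zᵀQz) z` is ODD. [folklore] -/
theorem quadShell_odd (h : ℝ → ℝ) (Q : E3 →L[ℝ] E3) (z : E3) :
    (fun z : E3 => (h (‖z‖ ^ 2) * quadHarmonic Q z) • z) (-z) = -(fun z : E3 => (h (‖z‖ ^ 2) * quadHarmonic Q z) • z) z := by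
  simp only [quadHarmonic, norm_neg, map_neg, inner_neg_left, inner_neg_right, neg_neg, smul_neg]

end ShellParity

end Summit.NavierStokesRegularity.NavierStokesRegularity.Theorems.UnthreadedRigidity.MixedPair

end
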